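import Mathlib
import Summits.PneNP.PneNP.Theorems.RamseyUncertifiableRegularResolutionRungTrapSparseFalseLinAlg

/-!
# The points / affine-hyperplanes graph over `F₂^d` (helper 2/5 for `stub_not_biDenseTrapSparse`)

Vertices `Vtx d := Vec d ⊕ Hyp d`: the POINTS `x : F₂^d` and the affine HYPERPLANES `p = (a, b)`, `a ≠ 0`
(`p` is the hyperplane `{x : ⟪a, x⟫ = b}`). Adjacency (`hadamardGraph d`):
* point–hyperplane: incidence, `⟪a, x⟫ = b`;
* point–point: `x ≠ y ∧ ⟪x, y⟫ = 1`;
* hyperplane–hyperplane: `p ≠ p' ∧ ⟪a, a'⟫ + b·b' = 1`.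
Every block is a ±1 character-sum ("Hadamard") matrix, which is what makes the graph two-sided bi-dense
(file 3), while common neighbourhoods of hyperplanes inside the point part are affine subspaces, which is
what produces exponentially many sound minimal traps (file 4). This file: the definition, the vertex count
`3·2^d − 2`, and the common-neighbourhood COUNTS in terms of the affine solution sets of file 1.
[folklore]
-/

noncomputable section

open Finset Matrix Module
open scoped Classical

namespace Summit.PneNP.PneNP.Cruxes.RegularResolutionRung.SoundPathBottleneck.HadamardWitness

set_option linter.dupNamespace false -- `Summit.PneNP.PneNP.…`: single-conjunct summit (D-0017)

variable {d : ℕ}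

/-- Affine hyperplanes of `F₂^d`: pairs `(a, b)` with `a ≠ 0`. -/
abbrev Hyp (d : ℕ) := {p : Vec d × ZMod 2 // p.1 ≠ 0}

/-- The normal vector of a hyperplane. -/
abbrev Hyp.a (p : Hyp d) : Vec d := p.1.1
/-- The constant term of a hyperplane. -/
abbrev Hyp.b (p : Hyp d) : ZMod 2 := p.1.2

/-- Vertices: points and hyperplanes. -/
abbrev Vtx (d : ℕ) := Vec d ⊕ Hyp d

/-- The adjacency relation. -/
def hadj : Vtx d → Vtx d → Prop
  | Sum.inl x, Sum.inl y => x ≠ y ∧ x ⬝ᵥ y = 1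
  | Sum.inr p, Sum.inr p' => p ≠ p' ∧ p.a ⬝ᵥ p'.a + p.b * p'.b = 1
  | Sum.inl x, Sum.inr p => p.a ⬝ᵥ x = p.b
  | Sum.inr p, Sum.inl x => p.a ⬝ᵥ x = p.b

/-- Symmetry of `hadj`. -/
theorem hadj_symm : ∀ u v : Vtx d, hadj u v → hadj v u := by
  rintro (x | p) (y | p') h
  · exact ⟨fun e => h.1 e.symm, by rw [dotProduct_comm]; exact h.2⟩
  · exact h
  · exact h
  · refine ⟨fun e => h.1 e.symm, ?_⟩
    have := h.2
    rw [dotProduct_comm, mul_comm]; exact this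

/-- Irreflexivity of `hadj`. -/
theorem hadj_irrefl : ∀ u : Vtx d, ¬ hadj u u := by
  rintro (x | p) h
  · exact h.1 rfl
  · exact h.1 rfl

/-- **The points / affine-hyperplanes graph over `F₂^d`.** -/
def hadamardGraph (d : ℕ) : SimpleGraph (Vtx d) where
  Adj := hadj
  symm := ⟨hadj_symm⟩
  loopless := ⟨hadj_irrefl⟩

/-- Classical decidability of adjacency (the line's vocabulary takes `[DecidableRel H.Adj]`). -/
instance : DecidableRel (hadamardGraph d).Adj := fun _ _ => Classical.propDecidable _

/-- Adjacency of two points. -/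
@[simp] theorem adj_inl_inl {x y : Vec d} : (hadamardGraph d).Adj (Sum.inl x) (Sum.inl y) ↔ x ≠ y ∧ x ⬝ᵥ y = 1 :=
  Iff.rfl
/-- Adjacency of two hyperplanes. -/
@[simp] theorem adj_inr_inr {p p' : Hyp d} :
    (hadamardGraph d).Adj (Sum.inr p) (Sum.inr p') ↔ p ≠ p' ∧ p.a ⬝ᵥ p'.a + p.b * p'.b = 1 := Iff.rfl
/-- Adjacency point–hyperplane (incidence). -/
@[simp] theorem adj_inl_inr {x : Vec d} {p : Hyp d} : (hadamardGraph d).Adj (Sum.inl x) (Sum.inr p) ↔ p.a ⬝ᵥ x = p.b :=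
  Iff.rfl
/-- Adjacency hyperplane–point (incidence). -/
@[simp] theorem adj_inr_inl {x : Vec d} {p : Hyp d} : (hadamardGraph d).Adj (Sum.inr p) (Sum.inl x) ↔ p.a ⬝ᵥ x = p.b :=
  Iff.rfl

/-- The number of hyperplanes: `2·2^d − 2`. -/
theorem card_Hyp (d : ℕ) : Fintype.card (Hyp d) = 2 * 2 ^ d - 2 := by
  rw [Fintype.card_subtype_compl, Fintype.card_prod, Fintype.card_fun, ZMod.card, Fintype.card_fin]
  have : Fintype.card {p : Vec d × ZMod 2 // p.1 = 0} = 2 := by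
    rw [Fintype.card_eq.2 ⟨⟨fun p => p.1.2, fun b => ⟨(0, b), rfl⟩, fun p => by
      obtain ⟨⟨a, b⟩, h⟩ := p; simp only at h; subst h; rfl, fun b => rfl⟩⟩]
    exact ZMod.card 2
  rw [this]
  ring_nf

/-- The number of vertices: `3·2^d − 2`. -/
theorem card_Vtx (d : ℕ) : Fintype.card (Vtx d) = 3 * 2 ^ d - 2 := by
  rw [Fintype.card_sum, card_Hyp, Fintype.card_fun, ZMod.card, Fintype.card_fin]
  have : 2 ≤ 2 * 2 ^ d := by
    have := Nat.one_le_two_pow (n := d); omega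
  omega

/-! ## Common neighbourhoods of a set of hyperplanes -/

/-- The points lying on every hyperplane of `U`. -/
def ptsOn (U : Finset (Hyp d)) : Finset (Vec d) := univ.filter fun x => ∀ p ∈ U, p.a ⬝ᵥ x = p.b

/-- The hyperplanes adjacent to every hyperplane of `U`. -/
def hypsAdj (U : Finset (Hyp d)) : Finset (Hyp d) :=
  univ.filter fun p' => ∀ p ∈ U, p ≠ p' ∧ p.a ⬝ᵥ p'.a + p.b * p'.b = 1

/-- The common neighbourhood of `U ⊆ Hyp` in the whole graph splits into its point part and its
hyperplane part. -/
theorem card_commonNbhd_inr (U : Finset (Hyp d)) :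
    (univ.filter fun v : Vtx d => ∀ p ∈ U, (hadamardGraph d).Adj (Sum.inr p) v).card =
      (ptsOn U).card + (hypsAdj U).card := by
  have hsplit : (univ.filter fun v : Vtx d => ∀ p ∈ U, (hadamardGraph d).Adj (Sum.inr p) v) =
      (ptsOn U).map ⟨Sum.inl, Sum.inl_injective⟩ ∪ (hypsAdj U).map ⟨Sum.inr, Sum.inr_injective⟩ := by
    ext v
    rcases v with x | p'
    · simp [ptsOn]
    · simp [hypsAdj]
  rw [hsplit, Finset.card_union_of_disjoint, Finset.card_map, Finset.card_map]
  rw [Finset.disjoint_left]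
  intro v h1 h2
  simp only [Finset.mem_map, Function.Embedding.coeFn_mk] at h1 h2
  obtain ⟨x, -, rfl⟩ := h1
  obtain ⟨p, -, h⟩ := h2
  exact Sum.inr_ne_inl h

/-- The system matrix and right-hand side of a finset of hyperplanes, indexed by `Fin U.card`. -/
def sysMat (U : Finset (Hyp d)) : Matrix (Fin U.card) (Fin d) (ZMod 2) := fun i => (U.equivFin.symm i).1.a
/-- Right-hand sides `b_p`. -/
def sysRhs (U : Finset (Hyp d)) : Fin U.card → ZMod 2 := fun i => (U.equivFin.symm i).1.b

/-- `U` has LINEARLY INDEPENDENT normals. -/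
def IndepNormals (U : Finset (Hyp d)) : Prop := LinearIndependent (ZMod 2) fun p : U => (p : Hyp d).a

/-- Independence transfers to the rows of the system matrix. -/
theorem indep_rows {U : Finset (Hyp d)} (h : IndepNormals U) : LinearIndependent (ZMod 2) (sysMat U).row := by
  unfold IndepNormals at h
  have : (sysMat U).row = (fun p : U => (p : Hyp d).a) ∘ U.equivFin.symm := by
    funext i; rfl
  rw [this]
  exact h.comp _ U.equivFin.symm.injective

/-- `ptsOn U` is the solution set of the system of `U`. -/
theorem ptsOn_eq_solSet (U : Finset (Hyp d)) : ptsOn U = solSet (sysMat U) (sysRhs U) := by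
  ext x
  simp only [ptsOn, Finset.mem_filter, Finset.mem_univ, true_and, mem_solSet]
  constructor
  · intro h
    funext i
    exact h _ (U.equivFin.symm i).2
  · intro h p hp
    have := congrFun h (U.equivFin ⟨p, hp⟩)
    simpa [sysMat, sysRhs, mulVec] using this

/-- **Point count.** If `U` has independent normals then exactly `2^(d - |U|)` points lie on every
hyperplane of `U` (and `|U| ≤ d`). -/
theorem card_ptsOn {U : Finset (Hyp d)} (h : IndepNormals U) :
    (ptsOn U).card = 2 ^ (d - U.card) ∧ U.card ≤ d := by
  rw [ptsOn_eq_solSet]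
  exact card_solSet _ (indep_rows h) _

/-- A hyperplane-side count: for fixed `β`, the hyperplanes `(a', β)` adjacent to all of `U` inject into
the solution set of the system `⟪a_p, a'⟫ = 1 + b_p β`. Hence at most `2 · 2^(d - |U|)` hyperplanes are
adjacent to every member of an independent `U`. -/
theorem card_hypsAdj_le {U : Finset (Hyp d)} (h : IndepNormals U) :
    (hypsAdj U).card ≤ 2 * 2 ^ (d - U.card) := by
  -- split by the constant term β of the candidate hyperplane
  have key : ∀ β : ZMod 2,
      ((hypsAdj U).filter fun p' => p'.b = β).card ≤ 2 ^ (d - U.card) := by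
    intro β
    have hsol := (card_solSet (sysMat U) (indep_rows h) (fun i => 1 + sysRhs U i * β)).1
    rw [← hsol]
    refine Finset.card_le_card_of_injOn (fun p' => p'.a) ?_ ?_
    · intro p' hp'
      simp only [Finset.coe_filter, Set.mem_setOf_eq, hypsAdj, Finset.mem_filter, Finset.mem_univ,
        true_and] at hp'
      obtain ⟨hall, rfl⟩ := hp'
      rw [Finset.mem_coe, mem_solSet]
      funext i
      have := (hall _ (U.equivFin.symm i).2).2
      simp only [sysMat, sysRhs, mulVec]
      -- ⟪a_p, a'⟫ + b_p β = 1  ⇒  ⟪a_p, a'⟫ = 1 + b_p β  over ZMod 2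
      have e : ∀ u v : ZMod 2, u + v = 1 → u = 1 + v := by decide
      exact e _ _ this
    · intro p₁ h₁ p₂ h₂ heq
      simp only [Finset.coe_filter, Set.mem_setOf_eq] at h₁ h₂
      apply Subtype.ext
      exact Prod.ext heq (h₁.2.trans h₂.2.symm)
  have hsplit := Finset.card_filter_add_card_filter_not (s := hypsAdj U) (fun p' => p'.b = 0)
  have h0 := key 0
  have h1 : ((hypsAdj U).filter fun p' => ¬ p'.b = 0).card ≤ 2 ^ (d - U.card) := by
    have : ((hypsAdj U).filter fun p' => ¬ p'.b = 0) = ((hypsAdj U).filter fun p' => p'.b = 1) := by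
      refine Finset.filter_congr fun p' _ => ?_
      have : ∀ u : ZMod 2, ¬ u = 0 ↔ u = 1 := by decide
      exact this _
    rw [this]; exact key 1
  omega

/-- Anchor (registered sub-goal `hw_graph_anchor` of stmt-PneNP-9818): the vertex count of the witness. -/
theorem hw_graph_anchor : ∀ d : ℕ, Fintype.card (Vtx d) = 3 * 2 ^ d - 2 := card_Vtx

end Summit.PneNP.PneNP.Cruxes.RegularResolutionRung.SoundPathBottleneck.HadamardWitness

end
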